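import Summits.ABC.IUTFork.Cor312PinnedSetting
import Summits.ABC.IUTFork.Thm311ToCor312
import HarnessLib

/-!
# [IUTchIII] Cor. 3.12 — the PINNED naive model, II: the setting of record and the two region OPERATORS (PR-2)

Record-only file (D-0012) of the abc-iut cell (wave-4 prover abc-iut-w4-d101, gen 2; director-abc 2026-08-26T01:56:18Z
«PINNED-REGIONS ROUND», deliverable PR-2 (G3″)). Sequel to `Cor312PinnedSetting` (part I, p418585: the value monoid `q^ℕ`, the
honest Prop. 3.7 output `pinSig`, the setting `pinSetting p` over abc-iut-w5-d247's naive `p`-adic model whose glue fields READ the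
pilot objects; `thetaPilot = 1 = qPilot`, `thetaRegion m j = B_{j²}`, `−|log(Θ)| = (5/2)·(−|log(q)|)`, `BridgeHyps`, `¬Statement`).
TAKES NO SIDE on [IUTchIII] Cor. 3.12; introduces NO `Prop` fact. MODEL DATA defined here:

* `pinnedSetting p` — THE SETTING OF RECORD for PR-2: `pinSetting p` with the q-side glue's ZERO-LABEL convention aligned with the
  Θ-side (both glue fields give the trivial ideal `𝒪 = B_0` at the label `0 ∉ 𝔽_l^⋇`, where neither pilot object has a component —
  [IUTchIII] Def. 3.8 (i): objects of `∏_{j ∈ 𝔽_l^⋇}` — and which Cor. 3.12 never reads), so that ONE region operator serves both pins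
  of abc-iut-w5-d230's `PinnedRegions` (p417551 `Cor312PinnedRegions`; its q-pin quantifies over every label). All printed quantities
  are those of `pinSetting p` (same Θ-glue; same q-regions on `𝔽_l^⋇`). (`pinSetting` itself stays as landed: append-only.)
* `orbitRegion Ψ j v_ℚ := Ψ_j·𝒪` — the MONOID-TO-REGION operator: the orbit of the integral structure `B_0 = 𝒪` under the
  `j`-components of the elements of a bad-place splitting-monoid datum `Ψ` (the data (i)(b) of Thm. 3.11 «equipped with a(n)
  [multiplicative] action on `∏_j 𝓘^ℚ(…)`», kurims `paper:url-4b091feeb646` p. 154 — coordinatewise multiplication in w5-d247's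
  model; a different normal form of abc-iut-w5-d230's `GluedMonoids.Naive.ballOfMonoid` «smallest ball containing the
  `j`-components», with which it agrees on the data used here); PROVED: equivariant under the whole group ⟨(Ind1) ∪ (Ind2)⟩ (=
  hypothesis (hρ) of p417551), NOT constant (`∅ ↦ ∅`), and `Ψ_v = {(±q^{j²})_j} ↦ B_{j²}`;
* `kummerOfExp Q` — the HONEST bad-place Kummer datum of a q-pilot datum `Q`: the torsion-translates `(±q^e)_j` of the constant tuple
  of its `q`-parameter (`e :=` the exponent READ OFF `Q.q`; the labels of `†𝒞^⊩_△` are identified, [IUTchII] Cor. 4.10 (i) "△");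
  `qDatum p := kummerOfExp (pinnedSetting p).qData`, and `orbitRegion qDatum j = B_1 = q·𝒪` on `𝔽_l^⋇`;
* `pinnedLinkGluing` — c312-11's object-level Θ×μ_LGP-link gluing (Step (xi-a), p. 181 l. 33–44) INSTANTIATED: the full
  poly-isomorphism of the split value monoids `q^ℕ ≅ q^ℕ` carries generator to generator, i.e. exponent-`k` objects to exponent-`k`
  objects; it carries the Θ-pilot object to the q-pilot object.

The PINS themselves (`PinnedRegions` HOLDS for `(orbitRegion, qDatum)`), `¬GapA″`, the failure of Reading R3 / the (xi-f) licence /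
`TwoWays`, and the packaged countermodel are the proof-only sequel `Cor312PinnedCountermodel.lean`. Interface-level witness over
`toyIndex` (`l⋇ = 2`); NOT a model of initial Θ-data; no judgement on print. [claim: Mochizuki2012, status: disputed]
[cite: ScholzeStix2018, §2.2 pp. 9–10]
-/

noncomputable section

open Set

namespace Summit.ABC

namespace IUTFork

namespace Cor312Vol

namespace PinnedWitness

open Thm311 Cor312 Cor312.Checks Cor312.IdentifiedNonVacuity NaiveWitness Literature.IUT.LogThetaLattice

variable (p : ℕ)

/-! ## 0. The setting of record: the zero-label convention of the q-side glue -/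

/-- **The PINNED SETTING OF RECORD** (PR-2): `pinSetting p` (part I) with the q-side glue returning the trivial ideal `𝒪 = B_0`
at the zero label, as the Θ-side glue does (`B_{k·0²}`); at the labels `j ∈ 𝔽_l^⋇` the `△`-object of exponent `k` is glued to
`B_k` as before. Everything else — packets, frames, volumes, the honest object side, the Θ-glue — is `pinSetting p` verbatim.
[claim: Mochizuki2012, status: disputed] -/
def pinnedSetting : Setting (naiveSituation p) :=
  { pinSetting p with
    qRegionOf := fun k j vQ => if j = 0 then pBall p j vQ 0 else pBall p j vQ (k : ℤ)
    qRegion_mem := fun j _ => by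
      by_cases h : j = 0
      · exact ⟨0, by rw [if_pos h]⟩
      · exact ⟨_, by rw [if_neg h]⟩
    qSupport_finite := fun _ => Set.toFinite _ }

/-- The Θ-side of the setting of record IS that of `pinSetting p` (same glue, same pilot object). [folklore] -/
theorem pinnedSetting_thetaRegion_eq : (pinnedSetting p).thetaRegion = (pinSetting p).thetaRegion := rfl

/-- … so its `(n,m)`-Kummer images of the Θ-pilot object are the balls `B_{j²}` … [folklore] -/
theorem pinnedSetting_thetaRegion (m : ℤ) (j : toyIndex.Label) (vQ : toyIndex.VQ) :
    (pinnedSetting p).thetaRegion m j vQ = pBall p j vQ (jsq j) :=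
  pinSetting_thetaRegion p m j vQ

/-- … its (Ind3)-enlarged region is `B_{j²}` … [folklore] -/
theorem pinnedSetting_thetaRegion3 (j : toyIndex.Label) (vQ : toyIndex.VQ) :
    (pinnedSetting p).thetaRegion3 j vQ = pBall p j vQ (jsq j) :=
  pinSetting_thetaRegion3 p j vQ

/-- … and its possible images are the singleton `{B_{j²}}`. [folklore] -/
theorem pinnedSetting_possibleImages (j : toyIndex.Label) (vQ : toyIndex.VQ) :
    (pinnedSetting p).possibleImages j vQ = {pBall p j vQ (jsq j)} :=
  pinSetting_possibleImages p j vQ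

/-- The Θ-pilot object is the lgp-object of exponent `1`; the q-pilot object the `△`-object of exponent `1`. [folklore] -/
theorem pinnedSetting_pilots : (pinnedSetting p).thetaPilot = (1 : ℤ) ∧ (pinnedSetting p).qPilot = (1 : ℤ) :=
  ⟨pinSetting_thetaPilot p, rfl⟩

/-- The q-side glue field, unfolded: `𝒪` at the zero label, `B_k` elsewhere. [folklore] -/
theorem pinnedSetting_qRegionOf (k : ℤ) (j : toyIndex.Label) (vQ : toyIndex.VQ) :
    (pinnedSetting p).qRegionOf k j vQ = if j = 0 then pBall p j vQ 0 else pBall p j vQ k := rfl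

/-- At any nonzero label the image of the q-pilot object is `B_1 = q·𝒪` — COMPUTED from the object. [folklore] -/
theorem pinnedSetting_qRegion_of_ne_zero {j : toyIndex.Label} (hj : j ≠ 0) (vQ : toyIndex.VQ) :
    (pinnedSetting p).qRegion j vQ = pBall p j vQ 1 := by
  unfold Setting.qRegion
  rw [(pinnedSetting_pilots p).2, pinnedSetting_qRegionOf, if_neg hj]

/-- At the zero label (outside `𝔽_l^⋇`; read by nothing) the q-side glue gives `𝒪 = B_0`. [folklore] -/
theorem pinnedSetting_qRegion_zero (vQ : toyIndex.VQ) : (pinnedSetting p).qRegion 0 vQ = pBall p 0 vQ 0 := by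
  unfold Setting.qRegion
  rw [(pinnedSetting_pilots p).2, pinnedSetting_qRegionOf, if_pos rfl]

/-- At a label `j = i + 1 ∈ 𝔽_l^⋇` the q-pilot image is `B_1`, as for `pinSetting p`. [folklore] -/
theorem pinnedSetting_qRegion (i : Fin toyIndex.lstar) (vQ : toyIndex.VQ) :
    (pinnedSetting p).qRegion (Setting.labelSucc i) vQ = (pinSetting p).qRegion (Setting.labelSucc i) vQ := by
  rw [pinnedSetting_qRegion_of_ne_zero p (Setting.labelSucc_ne_zero i)]; rfl

/-- Congruence of `−|log(q)|` under equality of the column and of the q-regions AT THE LABELS OF `𝔽_l^⋇` (the only ones the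
printed average reads; c312-8's `Setting.negLogQ_congr` asks all labels). [folklore] -/
theorem negLogQ_congr_labelSucc {S : Situation toyIndex} (P P' : Setting S) (hn : P'.n = P.n)
    (hq : ∀ (i : Fin toyIndex.lstar) (vQ : toyIndex.VQ),
      P'.qRegion (Setting.labelSucc i) vQ = P.qRegion (Setting.labelSucc i) vQ) :
    P'.negLogQ = P.negLogQ := by
  unfold Setting.negLogQ Setting.qLocal
  rw [hn]
  congr 1
  funext i
  exact finsum_congr fun vQ => by rw [hq]

variable [hp : Fact p.Prime]

/-- `−|log(Θ)| = −(5/2)·log p` (same Θ-side as `pinSetting p`). [folklore] -/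
theorem pinnedSetting_negLogTheta : (pinnedSetting p).negLogTheta = ((-(5 / 2) * Real.log p : ℝ) : WithTop ℝ) := by
  rw [← pinSetting_negLogTheta p]
  exact Setting.negLogTheta_congr (pinSetting p) (pinnedSetting p) rfl (fun _ _ => rfl) fun _ _ => rfl

/-- `−|log(q)| = −log p`. [folklore] -/
theorem pinnedSetting_negLogQ : (pinnedSetting p).negLogQ = -Real.log p := by
  rw [← pinSetting_negLogQ p]
  exact negLogQ_congr_labelSucc (pinSetting p) (pinnedSetting p) rfl (pinnedSetting_qRegion p)

/-- **`|log(q)| > 0`.** [folklore] -/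
theorem pinnedSetting_absLogQPos : (pinnedSetting p).AbsLogQPos := by
  show (pinnedSetting p).negLogQ < 0
  rw [pinnedSetting_negLogQ, neg_lt_zero]
  exact log_p_pos p

/-- **The typed Corollary 3.12 FAILS**: `−|log(q)| = −log p > −(5/2)·log p = −|log(Θ)|`. [folklore] -/
theorem pinnedSetting_not_statement : ¬ (pinnedSetting p).Statement := by
  rintro ⟨-, hle⟩
  rw [pinnedSetting_negLogQ, pinnedSetting_negLogTheta, WithTop.coe_le_coe] at hle
  have := log_p_pos p
  linarith

/-- `−|log(Θ)| = (5/2)·(−|log(q)|)`. [folklore] -/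
theorem pinnedSetting_negLogTheta_eq_mul_negLogQ :
    (pinnedSetting p).negLogTheta = (((5 : ℝ) / 2 * (pinnedSetting p).negLogQ : ℝ) : WithTop ℝ) := by
  rw [pinnedSetting_negLogTheta, pinnedSetting_negLogQ]
  congr 1
  ring

/-- **All bridge hypotheses hold.** [folklore] -/
theorem pinnedSetting_bridgeHyps : BridgeHyps (pinnedSetting p) where
  mono := by
    rintro i vQ A B ⟨k, rfl⟩ ⟨k', rfl⟩ hAB
    exact pVol_mono p hAB
  image_adm := fun i vQ U hU => ⟨jsq _, by
    rw [pinnedSetting_possibleImages] at hU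
    exact hU⟩
  image_fin := fun _ => Set.toFinite _
  hul_nonempty := fun j vQ H hH => by obtain ⟨k, rfl⟩ := hH; exact ⟨0, zero_mem_pBall p j vQ k⟩
  theta_nonempty := fun i vQ => by rw [pinnedSetting_thetaRegion3]; exact ⟨0, zero_mem_pBall p _ vQ _⟩
  finite := (Setting.thetaFinite_congr (pinSetting p) (pinnedSetting p) rfl (fun _ _ => rfl) fun _ _ => rfl).2
    (pinSetting_thetaFinite p)

omit hp in
/-- Every Kummer image of the Θ-pilot object is admissible. [folklore] -/
theorem pinnedSetting_thetaRegionsAdm : ThetaRegionsAdm (pinnedSetting p) := pinSetting_thetaRegionsAdm p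

/-! ## 1. The monoid-to-region operator `Ψ ↦ Ψ_j·𝒪` and its equivariance (hρ) -/

omit hp in
/-- **The monoid-to-region operator** `Ψ ↦ Ψ_j·𝒪` (module docstring): at `j ∈ 𝔽_l^⋇` the orbit of `B_0 = 𝒪` under the
`j`-components of the elements of `Ψ`; at the zero label (no component) `𝒪` itself. [claim: Mochizuki2012, status: disputed] -/
def orbitRegion (Ψ : ∀ v : toyIndex.V, v ∈ toyIndex.Vbad → Set (signShells.StarPacket v)) (j : toyIndex.Label)
    (vQ : toyIndex.VQ) : Set (signShells.Packet j vQ) :=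
  if h : j = 0 then pBall p j vQ 0 else
    {x | ∃ ψ ∈ Ψ vQ (Set.mem_univ _), ∃ u ∈ pBall p j vQ 0,
      line j vQ x = line j vQ (ψ ⟨j, h⟩) * line j vQ u}

omit hp in
/-- At the zero label the operator returns `𝒪`. [folklore] -/
theorem orbitRegion_zero (Ψ : ∀ v : toyIndex.V, v ∈ toyIndex.Vbad → Set (signShells.StarPacket v)) (vQ : toyIndex.VQ) :
    orbitRegion p Ψ 0 vQ = pBall p 0 vQ 0 := by
  unfold orbitRegion; rw [dif_pos rfl]

omit hp in
/-- At a nonzero label the EMPTY monoid determines the EMPTY region — the operator is not a constant. [folklore] -/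
theorem orbitRegion_empty {j : toyIndex.Label} (hj : j ≠ 0) (vQ : toyIndex.VQ) :
    orbitRegion p (fun _ _ => ∅) j vQ = ∅ := by
  unfold orbitRegion
  rw [dif_neg hj]
  ext x
  simp

omit hp in
/-- **EQUIVARIANCE (hρ) under the whole group ⟨(Ind1) ∪ (Ind2)⟩** (Thm. 3.11 (i) «functorial with respect to isomorphisms of
processions», p. 154): transporting the monoid by `Φ` transports the region by `Φ` — every such `Φ` acts on each packet line by a
sign (abc-iut-w4-d101's `actsBySigns_of_mem_closure`) and fixes `𝒪`. [folklore] -/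
theorem orbitRegion_equivariant {Φ : signShells.PacketAut}
    (hΦ : Φ ∈ Subgroup.closure (signShells.Ind1Family ∪ signShells.Ind2Family))
    (Ψ : ∀ v : toyIndex.V, v ∈ toyIndex.Vbad → Set (signShells.StarPacket v)) (j : toyIndex.Label) (vQ : toyIndex.VQ) :
    orbitRegion p (fun v hv => signShells.starAut Φ v '' Ψ v hv) j vQ = Φ j vQ '' orbitRegion p Ψ j vQ := by
  have hs := actsBySigns_of_mem_closure hΦ
  unfold orbitRegion
  split_ifs with h
  · exact (image_pBall_of_actsBySigns p hs j vQ 0).symm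
  · obtain ⟨ε, hε, hΦε⟩ := hs.sign j vQ
    have hε0 : ε ≠ 0 := by rintro rfl; norm_num at hε
    have h2 : ∀ ψ : signShells.StarPacket vQ,
        line j vQ (signShells.starAut Φ vQ ψ ⟨j, h⟩) = ε * line j vQ (ψ ⟨j, h⟩) := fun ψ => hΦε _
    ext x
    constructor
    · rintro ⟨_, ⟨ψ, hψ, rfl⟩, u, hu, hx⟩
      refine ⟨(Φ j vQ).symm x, ⟨ψ, hψ, u, hu, ?_⟩, LinearEquiv.apply_symm_apply _ _⟩
      have h1 := hΦε ((Φ j vQ).symm x)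
      rw [LinearEquiv.apply_symm_apply] at h1
      rw [h2] at hx
      have h3 : ε * line j vQ ((Φ j vQ).symm x) = ε * (line j vQ (ψ ⟨j, h⟩) * line j vQ u) := by
        rw [← h1, hx, mul_assoc]
      exact mul_left_cancel₀ hε0 h3
    · rintro ⟨y, ⟨ψ, hψ, u, hu, hy⟩, rfl⟩
      refine ⟨signShells.starAut Φ vQ ψ, ⟨ψ, hψ, rfl⟩, u, hu, ?_⟩
      rw [hΦε, h2, hy, mul_assoc]

/-- `q^e ≠ 0`. [folklore] -/
theorem pow_ne_zero' (e : ℕ) : ((p : ℚ) ^ e) ≠ 0 :=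
  pow_ne_zero _ (Nat.cast_ne_zero.mpr hp.out.ne_zero)

/-- Membership in `B_e` of `±q^e·c` versus membership in `B_0` of `c`. [folklore] -/
theorem mem_pBall_pow_iff {ε : ℚ} (hε : ε = 1 ∨ ε = -1) (e : ℕ) (c : ℚ) :
    (ε * (p : ℚ) ^ e * c = 0 ∨ (e : ℤ) ≤ padicValRat p (ε * (p : ℚ) ^ e * c)) ↔ (c = 0 ∨ 0 ≤ padicValRat p c) := by
  have hq := pow_ne_zero' p e
  have hε0 : ε ≠ 0 := by rcases hε with rfl | rfl <;> norm_num
  have hεv : padicValRat p ε = 0 := by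
    rcases hε with rfl | rfl
    · exact padicValRat.one
    · rw [padicValRat.neg]; exact padicValRat.one
  by_cases hc : c = 0
  · subst hc; simp
  · have hne : ε * (p : ℚ) ^ e * c ≠ 0 := mul_ne_zero (mul_ne_zero hε0 hq) hc
    rw [padicValRat.mul (mul_ne_zero hε0 hq) hc, padicValRat.mul hε0 hq, hεv, zero_add, ← zpow_natCast,
      padicValRat_ppow]
    constructor
    · rintro (h' | h')
      · exact absurd h' hne
      · exact Or.inr (by linarith)
    · rintro (h' | h')
      · exact absurd h' hc
      · exact Or.inr (by linarith)

/-- The orbit of `𝒪` under a tuple ALL of whose torsion-translates have `j`-component `±q^e` is `B_e = q^e·𝒪`, for any tuple set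
`Ψ` containing the tuple `(q^{e_j})_j` itself. (Common computation for the Θ-monoid and the q-datum.) [folklore] -/
theorem orbitRegion_eq_pBall_of {j : toyIndex.Label} (hj : j ≠ 0) (vQ : toyIndex.VQ)
    (Ψ : ∀ v : toyIndex.V, v ∈ toyIndex.Vbad → Set (signShells.StarPacket v)) (e : ℕ)
    (hΨ : ∀ ψ ∈ Ψ vQ (Set.mem_univ _),
      line j vQ (ψ ⟨j, hj⟩) = (p : ℚ) ^ e ∨ line j vQ (ψ ⟨j, hj⟩) = -(p : ℚ) ^ e)
    (ψ₀ : signShells.StarPacket vQ) (hψ₀ : ψ₀ ∈ Ψ vQ (Set.mem_univ _)) (hψ₀j : line j vQ (ψ₀ ⟨j, hj⟩) = (p : ℚ) ^ e) :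
    orbitRegion p Ψ j vQ = pBall p j vQ e := by
  unfold orbitRegion
  rw [dif_neg hj]
  ext x
  constructor
  · rintro ⟨ψ, hψ, u, hu, hx⟩
    show line j vQ x = 0 ∨ ((e : ℕ) : ℤ) ≤ padicValRat p (line j vQ x)
    rcases hΨ ψ hψ with h1 | h1
    · rw [hx, h1, ← one_mul ((p : ℚ) ^ e)]
      exact (mem_pBall_pow_iff p (Or.inl rfl) _ _).2 hu
    · rw [hx, h1, neg_eq_neg_one_mul]
      exact (mem_pBall_pow_iff p (Or.inr rfl) _ _).2 hu
  · intro hx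
    have hx' : line j vQ x = 0 ∨ ((e : ℕ) : ℤ) ≤ padicValRat p (line j vQ x) := hx
    refine ⟨ψ₀, hψ₀, (line j vQ).symm (line j vQ x / (p : ℚ) ^ e), ?_, ?_⟩
    · show line j vQ _ = 0 ∨ (0 : ℤ) ≤ padicValRat p (line j vQ _)
      rw [LinearEquiv.apply_symm_apply, ← mem_pBall_pow_iff p (Or.inl rfl) e, one_mul,
        mul_div_cancel₀ _ (pow_ne_zero' p _)]
      exact hx'
    · rw [LinearEquiv.apply_symm_apply, hψ₀j, mul_div_cancel₀ _ (pow_ne_zero' p _)]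

/-- **The operator EVALUATED on the splitting monoid `Ψ_v = {(±q^{j²})_j}` gives `B_{j²} = q^{j²}·𝒪`.** [folklore] -/
theorem orbitRegion_Psi (j : toyIndex.Label) (vQ : toyIndex.VQ) :
    orbitRegion p (fun v _ => Psi p v) j vQ = pBall p j vQ (jsq j) := by
  by_cases hj : j = 0
  · subst hj; exact orbitRegion_zero p _ vQ
  · exact orbitRegion_eq_pBall_of p hj vQ _ ((j : ℕ) ^ 2) (fun ψ hψ => hψ ⟨j, hj⟩) (thetaValues p vQ)
      (thetaValues_mem_Psi p vQ) (LinearEquiv.apply_symm_apply _ _)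

/-! ## 2. The honest Kummer datum of the q-pilot -/

omit hp in
/-- **The bad-place Kummer datum of a q-pilot datum** `Q` (the q-side input `qK` of w5-d230's `QPinned`, here COMPUTED from `Q`,
not free): the torsion-translates `(±q^e)_{j ∈ 𝔽_l^⋇}` of the constant tuple of the `q`-parameter, `e :=` the exponent read off
`Q.q` (labels identified by "△", [IUTchII] Cor. 4.10 (i)). [claim: Mochizuki2012, status: disputed] -/
def kummerOfExp (Q : QPilotData (pinnedSetting p).ObΔ (pinnedSetting p).N) :
    ∀ v : toyIndex.V, v ∈ toyIndex.Vbad → Set (signShells.StarPacket v) := fun v _ =>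
  {ψ | ∀ j : toyIndex.LabelStar,
    line j.1 (toyIndex.over v) (ψ j) = (p : ℚ) ^ expOf (Q.q v (Set.mem_univ _)) ∨
      line j.1 (toyIndex.over v) (ψ j) = -(p : ℚ) ^ expOf (Q.q v (Set.mem_univ _))}

omit hp in
/-- `qDatum p :=` the Kummer datum of THE SETTING'S OWN q-pilot datum (`q_v = gen`, exponent `1`): `{(±q)_j}`.
[claim: Mochizuki2012, status: disputed] -/
def qDatum : ∀ v : toyIndex.V, v ∈ toyIndex.Vbad → Set (signShells.StarPacket v) := kummerOfExp p (pinnedSetting p).qData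

omit hp in
/-- The exponent read off the setting's q-pilot datum is `1`. [folklore] -/
theorem expOf_qData (v : toyIndex.V) : expOf ((pinnedSetting p).qData.q v (Set.mem_univ _)) = 1 := rfl

omit hp in
/-- The constant tuple `(q)_j` lies in `qDatum` (which is therefore nonempty). [folklore] -/
theorem qTuple_mem_qDatum (v : toyIndex.V) :
    (fun j : toyIndex.LabelStar => (line j.1 (toyIndex.over v)).symm (p : ℚ)) ∈ qDatum p v (Set.mem_univ _) :=
  fun _ => Or.inl (by rw [LinearEquiv.apply_symm_apply, expOf_qData, pow_one])

/-- **The operator EVALUATED on the q-pilot's Kummer datum gives `B_1 = q·𝒪`** at every label of `𝔽_l^⋇`. [folklore] -/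
theorem orbitRegion_qDatum {j : toyIndex.Label} (hj : j ≠ 0) (vQ : toyIndex.VQ) :
    orbitRegion p (qDatum p) j vQ = pBall p j vQ 1 := by
  refine orbitRegion_eq_pBall_of p hj vQ _ 1 (fun ψ hψ => ?_) _ (qTuple_mem_qDatum p vQ) ?_
  · have h := hψ ⟨j, hj⟩
    rw [expOf_qData] at h
    exact h
  · show line j vQ ((line j vQ).symm (p : ℚ)) = _
    rw [LinearEquiv.apply_symm_apply, pow_one]

/-! ## 3. The OBJECT-level Θ×μ_LGP-link gluing -/

/-- **c312-11's link gluing on objects, INSTANTIATED** (Step (xi-a), p. 181 l. 33–44): the identity on exponents carries the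
Θ-pilot object (exponent `1`) to the q-pilot object (exponent `1`). [claim: Mochizuki2012, status: disputed] -/
def pinnedLinkGluing : LinkGluing (pinnedSetting p) where
  linkMap := fun k => k
  link_thetaPilot := by rw [(pinnedSetting_pilots p).1]; rfl

omit hp in
/-- c312-1's object-level `PilotLink` holds (the identity of exponents). [folklore] -/
theorem pinnedSetting_pilotLink : Thm311ToCor312.PilotLink (pinnedSetting p) :=
  ⟨Equiv.refl ℤ, by rw [(pinnedSetting_pilots p).1]; rfl⟩

end PinnedWitness

end Cor312Vol

end IUTFork

end Summit.ABC

end
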